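import Mathlib.Analysis.Distribution.SchwartzSpace.Basic
import Mathlib.Analysis.Calculus.BumpFunction.FiniteDimension
import Mathlib.Analysis.Calculus.SmoothSeries
import HarnessLib

/-!
# Schwartz envelopes: a uniformly rapidly decreasing family is dominated by ONE Schwartz function

Topic `Analysis/Distribution`; namespace `Literature.Analysis.Distribution`.  KERNEL mathematics only (theorems; no
definition, no named fact, no `axiom`, no proof hole).

Let `V` be a finite-dimensional real normed space.  A function `G : V → ℝ` is *rapidly decreasing* when
`sup_x (1 + ‖x‖)^N |G x| < ∞` for every `N`.  Such a `G` need not be smooth (typical examples: `G = sup_{t ∈ T} |Ψ_t|`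
for a compact family of Schwartz functions, `G = |Ψ ∘ g|` for a family of linear automorphisms `g`), but it is always
dominated pointwise by a genuine SCHWARTZ function:

* `exists_schwartz_ge_of_rapid_decay` — **∃ Φ ∈ 𝓢(V, ℝ) with `|G x| ≤ Φ x` for all `x`** (and `0 ≤ Φ`);
* `exists_schwartz_forall_ge_of_uniform_rapid_decay` — the same for a FAMILY `(G_t)_{t ∈ T}` with uniform constants;
* `exists_schwartz_complex_ge_of_rapid_decay` — the `ℂ`-valued form (`Φ x = (Φ x).re ≥ |G x|`, `(Φ x).im = 0`) used by the
  adelic Schwartz–Bruhat spaces of the tree (`Automorphic/AdelicPiSchwartzBruhatFourier`: the archimedean factor is a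
  Mathlib `SchwartzMap` with values in `ℂ`).

Construction (dyadic bump envelope): with `χ` a smooth bump, `χ = 1` on the unit ball, supported in the ball of radius `2`,
`0 ≤ χ ≤ 1`, and `τ_k := min_{N ≤ k} C_N (2^{k-1})^{-N}` (`C_N` the decay constants of `G`), the series
`Φ(x) := Σ_{k ≥ 0} τ_k χ(2^{-k} x)` converges with all derivatives (`Σ_k τ_k 2^{k m} < ∞` for every `m`, since
`τ_k ≤ C_{m+1} (2^{k-1})^{-(m+1)}`), every term is non-negative, the `k(x)`-th term alone already dominates `|G x|`
where `2^{k(x)-1} < ‖x‖ ≤ 2^{k(x)}`, and the `(m, n)` Schwartz seminorm of the `k`-th term is `≤ τ_k (2^{k+1})^m M_n`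
(the derivatives of `x ↦ χ(2^{-k} x)` are those of `χ` composed with a contraction, and vanish off `‖x‖ < 2^{k+1}`).  This
is the standard smoothing-free proof that rapidly decreasing envelopes can be taken in `𝓢` (cf. [HormanderALPDO1, Chap. VII
§7.1 Def. 7.1.2, the space `𝓢` and its seminorms]; [Rudin1991, §7.3, rapidly decreasing functions]); it is the archimedean half of the «dominated families» input (G3) of
Weil's boundedness argument [Weil1965, Chap. V n° 50, Lemmas 21–23] in the E-2 engine of the cell.

Cell hodgecm-mathlib, FLOOR 0, engine E-2, row G3 (`--supports stmt-HodgeConjecture-24833`).  HC_CM is proved only modulo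
the printed citations until rung 0 closes; nothing in this file is about Hodge classes.

## References
* [HormanderALPDO1] L. Hörmander, *The Analysis of Linear Partial Differential Operators I*, Grundlehren 256, Springer,
  Chap. VII §7.1, Def. 7.1.2 (the space `𝓢` and its seminorms).
* [Rudin1991] W. Rudin, *Functional Analysis*, 2nd ed., McGraw-Hill (1991), §7.3 (rapidly decreasing functions `𝓢_n`).
* [Weil1965] A. Weil, *Sur la formule de Siegel dans la théorie des groupes classiques*, Acta Math. 113 (1965) 1–87,
  Chap. V n° 50.
-/

set_option autoImplicit false

noncomputable section

open Set Filter Topology Function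
open scoped ContDiff

namespace Literature.Analysis.Distribution

variable {V : Type*} [NormedAddCommGroup V] [NormedSpace ℝ V] [FiniteDimensional ℝ V]

/-! ## §1 The dyadic bumps `x ↦ χ(2^{-k} x)` and their seminorms -/

section Bumps

/-- A smooth bump `χ` on `V` with `χ = 1` on the closed unit ball and `supp χ ⊆ B(0, 2)`, `0 ≤ χ ≤ 1`, together with
uniform bounds `M n` for all its derivatives. [folklore] -/
private theorem exists_bump :
    ∃ χ : V → ℝ, ContDiff ℝ ∞ χ ∧ (∀ x, 0 ≤ χ x) ∧ (∀ x, χ x ≤ 1) ∧ (∀ x, ‖x‖ ≤ 1 → χ x = 1) ∧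
      (∀ x, 2 ≤ ‖x‖ → χ x = 0) ∧ ∀ n : ℕ, ∃ M : ℝ, 0 ≤ M ∧ ∀ x, ‖iteratedFDeriv ℝ n χ x‖ ≤ M := by
  let f : ContDiffBump (0 : V) := ⟨1, 2, zero_lt_one, one_lt_two⟩
  refine ⟨f, f.contDiff, fun x => f.nonneg, fun x => f.le_one, fun x hx => ?_, fun x hx => ?_, fun n => ?_⟩
  · exact f.one_of_mem_closedBall (by simpa using hx)
  · exact f.zero_of_le_dist (by simpa using hx)
  · -- a continuous function with compact support is bounded
    have hc : Continuous (iteratedFDeriv ℝ n (f : V → ℝ)) := f.contDiff.continuous_iteratedFDeriv (by exact_mod_cast le_top)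
    have hs : HasCompactSupport (iteratedFDeriv ℝ n (f : V → ℝ)) := f.hasCompactSupport.iteratedFDeriv n
    obtain ⟨M, hM⟩ := (hc.norm).bddAbove_range_of_hasCompactSupport hs.norm
    refine ⟨max M 0, le_max_right _ _, fun x => (le_max_left _ _).trans' (hM (Set.mem_range_self x))⟩

end Bumps

/-! ## §2 The envelope -/

section Envelope

omit [NormedSpace ℝ V] [FiniteDimensional ℝ V] in
/-- decay constants can be chosen non-negative and the decay can be read with `(1 + ‖x‖)⁻¹ ^ N`. [folklore] -/
private theorem decay_constants {G : V → ℝ} (hG : ∀ N : ℕ, ∃ C : ℝ, ∀ x, |G x| * (1 + ‖x‖) ^ N ≤ C) :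
    ∃ C : ℕ → ℝ, (∀ N, 0 ≤ C N) ∧ ∀ N x, |G x| ≤ C N * ((1 + ‖x‖) ^ N)⁻¹ := by
  choose C hC using hG
  refine ⟨fun N => max (C N) 0, fun N => le_max_right _ _, fun N x => ?_⟩
  have hpos : 0 < (1 + ‖x‖) ^ N := pow_pos (by positivity) N
  rw [le_mul_inv_iff₀ hpos]
  exact (hC N x).trans (le_max_left _ _)

/-- **Schwartz envelope of a rapidly decreasing function.**  If `|G x| (1 + ‖x‖)^N` is bounded for every `N`, there is a
non-negative Schwartz function `Φ` on `V` with `|G x| ≤ Φ x` for every `x`.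
[cite: HormanderALPDO1, Chap. VII §7.1 Def. 7.1.2] [cite: Rudin1991, §7.3] [cite: Weil1965, Chap. V n° 50] -/
theorem exists_schwartz_ge_of_rapid_decay {G : V → ℝ} (hG : ∀ N : ℕ, ∃ C : ℝ, ∀ x, |G x| * (1 + ‖x‖) ^ N ≤ C) :
    ∃ Φ : SchwartzMap V ℝ, (∀ x, 0 ≤ Φ x) ∧ ∀ x, |G x| ≤ Φ x := by
  obtain ⟨χ, hχs, hχ0, hχ1, hχone, hχzero, hχM⟩ := exists_bump (V := V)
  choose M hM0 hM using hχM
  obtain ⟨C, hC0, hC⟩ := decay_constants hG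
  -- the coefficients `τ k = min_{N ≤ k} C N * ((2^(k-1))^N)⁻¹`
  let τ : ℕ → ℝ := fun k =>
    (Finset.range (k + 1)).inf' ⟨0, by simp⟩ fun N => C N * (((2 : ℝ) ^ (k - 1)) ^ N)⁻¹
  have hτle : ∀ k N, N ≤ k → τ k ≤ C N * (((2 : ℝ) ^ (k - 1)) ^ N)⁻¹ := fun k N hN =>
    Finset.inf'_le _ (by simpa [Finset.mem_range] using Nat.lt_succ_of_le hN)
  have hτ0 : ∀ k, 0 ≤ τ k := fun k =>
    Finset.le_inf' _ _ fun N _ => mul_nonneg (hC0 N) (inv_nonneg.2 (by positivity))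
  -- `|G x| ≤ τ k` as soon as `2^(k-1) ≤ 1 + ‖x‖`
  have hGτ : ∀ k x, (2 : ℝ) ^ (k - 1) ≤ 1 + ‖x‖ → |G x| ≤ τ k := by
    intro k x hk
    refine Finset.le_inf' _ _ fun N _ => (hC N x).trans ?_
    have h2 : 0 < ((2 : ℝ) ^ (k - 1)) ^ N := by positivity
    exact mul_le_mul_of_nonneg_left ((inv_le_inv₀ (by positivity) h2).2 (pow_le_pow_left₀ (by positivity) hk N))
      (hC0 N)
  -- summability of `Σ_k τ k * (2^(k+1))^m` for every `m`
  have hsum : ∀ m : ℕ, Summable fun k => τ k * ((2 : ℝ) ^ (k + 1)) ^ m := by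
    intro m
    rw [← summable_nat_add_iff (m + 1)]
    have hb : ∀ k, τ (k + (m + 1)) * ((2 : ℝ) ^ (k + (m + 1) + 1)) ^ m ≤
        C (m + 1) * (2 : ℝ) ^ m * ((1 / 2 : ℝ) ^ k) := by
      intro k
      have h1 := hτle (k + (m + 1)) (m + 1) (by omega)
      have hk1 : k + (m + 1) - 1 = k + m := by omega
      rw [hk1] at h1
      have h2pos : (0 : ℝ) < ((2 : ℝ) ^ (k + m)) ^ (m + 1) := by positivity
      calc τ (k + (m + 1)) * ((2 : ℝ) ^ (k + (m + 1) + 1)) ^ m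
          ≤ C (m + 1) * (((2 : ℝ) ^ (k + m)) ^ (m + 1))⁻¹ * ((2 : ℝ) ^ (k + (m + 1) + 1)) ^ m :=
            mul_le_mul_of_nonneg_right h1 (by positivity)
        _ = C (m + 1) * (2 : ℝ) ^ m * ((1 / 2 : ℝ) ^ k) := by
            have e1 : ((2 : ℝ) ^ (k + (m + 1) + 1)) ^ m * (2 : ℝ) ^ k =
                (2 : ℝ) ^ m * ((2 : ℝ) ^ (k + m)) ^ (m + 1) := by
              rw [← pow_mul, ← pow_mul, ← pow_add, ← pow_add]
              congr 1
              ring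
            have e2 : ((2 : ℝ) ^ (k + (m + 1) + 1)) ^ m =
                (2 : ℝ) ^ m * ((2 : ℝ) ^ (k + m)) ^ (m + 1) * ((2 : ℝ) ^ k)⁻¹ := by
              rw [eq_mul_inv_iff_mul_eq₀ (by positivity)]
              exact e1
            have hX : ((2 : ℝ) ^ (k + m)) ^ (m + 1) ≠ 0 := by positivity
            have hY : (2 : ℝ) ^ k ≠ 0 := by positivity
            rw [e2, one_div, inv_pow]
            field_simp
    refine Summable.of_nonneg_of_le (fun k => mul_nonneg (hτ0 _) (by positivity)) hb ?_
    exact (summable_geometric_of_lt_one (by norm_num) (by norm_num)).mul_left _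
  -- the dyadic bumps `φ k x = τ k * χ (2^{-k} x)`
  let L : ℕ → V →L[ℝ] V := fun k => (((2 : ℝ) ^ k)⁻¹ : ℝ) • ContinuousLinearMap.id ℝ V
  have hL : ∀ k x, L k x = (((2 : ℝ) ^ k)⁻¹ : ℝ) • x := fun k x => rfl
  have hLnorm : ∀ k, ‖L k‖ ≤ 1 := by
    intro k
    refine ContinuousLinearMap.opNorm_le_bound _ zero_le_one fun x => ?_
    rw [hL, norm_smul, norm_inv, norm_pow, Real.norm_ofNat, one_mul]
    exact mul_le_of_le_one_left (norm_nonneg _) (inv_le_one_of_one_le₀ (one_le_pow₀ one_le_two))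
  let φ : ℕ → V → ℝ := fun k x => τ k * χ (L k x)
  have hχL : ∀ k, ContDiff ℝ ∞ (fun x => χ (L k x)) := fun k => hχs.comp (L k).contDiff
  have hφs : ∀ k, ContDiff ℝ ∞ (φ k) := fun k => contDiff_const.mul (hχL k)
  have hφ0 : ∀ k x, 0 ≤ φ k x := fun k x => mul_nonneg (hτ0 k) (hχ0 _)
  have hφle : ∀ k x, φ k x ≤ τ k := fun k x => mul_le_of_le_one_right (hτ0 k) (hχ1 _)
  -- derivatives of the bumps
  have hφd : ∀ (n k : ℕ) x, iteratedFDeriv ℝ n (φ k) x = τ k • iteratedFDeriv ℝ n (fun y => χ (L k y)) x := by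
    intro n k x
    have : φ k = τ k • fun y => χ (L k y) := rfl
    rw [this, iteratedFDeriv_const_smul_apply ((hχL k).contDiffAt.of_le (by exact_mod_cast le_top))]
  have hφderiv : ∀ (n k : ℕ) x, ‖iteratedFDeriv ℝ n (φ k) x‖ ≤ τ k * M n := by
    intro n k x
    rw [hφd, norm_smul, Real.norm_of_nonneg (hτ0 k)]
    refine mul_le_mul_of_nonneg_left ?_ (hτ0 k)
    have hcomp : (fun y => χ (L k y)) = χ ∘ L k := rfl
    rw [hcomp, (L k).iteratedFDeriv_comp_right hχs x (i := n) (by exact_mod_cast le_top)]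
    refine (ContinuousMultilinearMap.norm_compContinuousLinearMap_le _ _).trans ?_
    refine (mul_le_mul_of_nonneg_left (Finset.prod_le_one (fun _ _ => norm_nonneg _) fun _ _ => hLnorm k)
      (norm_nonneg _)).trans ?_
    rw [mul_one]
    exact hM n _
  have hφderiv0 : ∀ (n k : ℕ) x, (2 : ℝ) ^ (k + 1) < ‖x‖ → iteratedFDeriv ℝ n (φ k) x = 0 := by
    intro n k x hx
    have hev : (φ k) =ᶠ[𝓝 x] fun _ => 0 := by
      have hopen : IsOpen {y : V | (2 : ℝ) ^ (k + 1) < ‖y‖} := isOpen_lt continuous_const continuous_norm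
      filter_upwards [hopen.mem_nhds hx] with y hy
      have h2 : 2 ≤ ‖L k y‖ := by
        rw [hL, norm_smul, norm_inv, norm_pow, Real.norm_ofNat]
        rw [pow_succ] at hy
        have h2k : (0 : ℝ) < 2 ^ k := by positivity
        rw [le_inv_mul_iff₀ h2k]
        exact hy.le
      change τ k * χ (L k y) = 0
      rw [hχzero _ h2, mul_zero]
    rw [(hev.iteratedFDeriv ℝ n).self_of_nhds, iteratedFDeriv_fun_zero]
    rfl
  -- the envelope
  have hsumτ : Summable τ := by simpa using hsum 0
  let Φf : V → ℝ := fun x => ∑' k, φ k x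
  have hΦs : ContDiff ℝ ∞ Φf := by
    refine contDiff_tsum (N := (⊤ : ℕ∞)) (v := fun n k => τ k * M n) hφs (fun n _ => hsumτ.mul_right _) ?_
    intro n k x _
    exact hφderiv n k x
  have hΦderiv : ∀ (n : ℕ) x, iteratedFDeriv ℝ n Φf x = ∑' k, iteratedFDeriv ℝ n (φ k) x := fun n x =>
    iteratedFDeriv_tsum_apply (N := (⊤ : ℕ∞)) (v := fun n k => τ k * M n) hφs
      (fun n _ => hsumτ.mul_right _) (fun n k x _ => hφderiv n k x) (by exact_mod_cast le_top) x
  have hdecay : ∀ m n : ℕ, ∃ Cmn : ℝ, ∀ x, ‖x‖ ^ m * ‖iteratedFDeriv ℝ n Φf x‖ ≤ Cmn := by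
    intro m n
    refine ⟨∑' k, τ k * ((2 : ℝ) ^ (k + 1)) ^ m * M n, fun x => ?_⟩
    have hterm : ∀ k, ‖x‖ ^ m * ‖iteratedFDeriv ℝ n (φ k) x‖ ≤ τ k * ((2 : ℝ) ^ (k + 1)) ^ m * M n := by
      intro k
      by_cases hx : (2 : ℝ) ^ (k + 1) < ‖x‖
      · rw [hφderiv0 n k x hx, norm_zero, mul_zero]
        exact mul_nonneg (mul_nonneg (hτ0 k) (by positivity)) (hM0 n)
      · push Not at hx
        calc ‖x‖ ^ m * ‖iteratedFDeriv ℝ n (φ k) x‖ ≤ ((2 : ℝ) ^ (k + 1)) ^ m * (τ k * M n) :=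
              mul_le_mul (pow_le_pow_left₀ (norm_nonneg _) hx m) (hφderiv n k x) (norm_nonneg _) (by positivity)
          _ = τ k * ((2 : ℝ) ^ (k + 1)) ^ m * M n := by ring
    have hs : Summable fun k => τ k * ((2 : ℝ) ^ (k + 1)) ^ m * M n := (hsum m).mul_right _
    have hs' : Summable fun k => ‖x‖ ^ m * ‖iteratedFDeriv ℝ n (φ k) x‖ :=
      Summable.of_nonneg_of_le (fun k => mul_nonneg (by positivity) (norm_nonneg _)) hterm hs
    have hs'' : Summable fun k => ‖iteratedFDeriv ℝ n (φ k) x‖ :=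
      Summable.of_nonneg_of_le (fun k => norm_nonneg _) (fun k => hφderiv n k x) (hsumτ.mul_right _)
    rw [hΦderiv]
    calc ‖x‖ ^ m * ‖∑' k, iteratedFDeriv ℝ n (φ k) x‖
        ≤ ‖x‖ ^ m * ∑' k, ‖iteratedFDeriv ℝ n (φ k) x‖ :=
          mul_le_mul_of_nonneg_left (norm_tsum_le_tsum_norm hs'') (by positivity)
      _ = ∑' k, ‖x‖ ^ m * ‖iteratedFDeriv ℝ n (φ k) x‖ := by rw [← tsum_mul_left]
      _ ≤ ∑' k, τ k * ((2 : ℝ) ^ (k + 1)) ^ m * M n := hs'.tsum_le_tsum hterm hs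
  let Φ : SchwartzMap V ℝ := ⟨Φf, hΦs, hdecay⟩
  have hΦapply : ∀ x, Φ x = ∑' k, φ k x := fun x => rfl
  have hsumx : ∀ x, Summable fun k => φ k x := fun x =>
    Summable.of_nonneg_of_le (hφ0 · x) (hφle · x) hsumτ
  refine ⟨Φ, fun x => ?_, fun x => ?_⟩
  · rw [hΦapply]; exact tsum_nonneg fun k => hφ0 k x
  · -- the index `k` with `2^(k-1) < ‖x‖ ≤ 2^k` (or `k = 0` when `‖x‖ ≤ 1`)
    have hex : ∃ k : ℕ, ‖x‖ ≤ (2 : ℝ) ^ k := by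
      obtain ⟨k, hk⟩ := pow_unbounded_of_one_lt ‖x‖ (one_lt_two : (1 : ℝ) < 2)
      exact ⟨k, hk.le⟩
    let k := Nat.find hex
    have hk : ‖x‖ ≤ (2 : ℝ) ^ k := Nat.find_spec hex
    have hk' : (2 : ℝ) ^ (k - 1) ≤ 1 + ‖x‖ := by
      rcases Nat.eq_zero_or_pos k with h0 | hpos
      · rw [h0]; simp
      · have hmin := Nat.find_min hex (m := k - 1) (by omega)
        push Not at hmin
        linarith
    have hχ1x : χ (L k x) = 1 := by
      refine hχone _ ?_
      rw [hL, norm_smul, norm_inv, norm_pow, Real.norm_ofNat]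
      have h2k : (0 : ℝ) < 2 ^ k := by positivity
      rw [inv_mul_le_iff₀ h2k, mul_one]
      exact hk
    calc |G x| ≤ τ k := hGτ k x hk'
      _ = φ k x := by change τ k = τ k * χ (L k x); rw [hχ1x, mul_one]
      _ ≤ ∑' j, φ j x := (hsumx x).le_tsum k fun j _ => hφ0 j x
      _ = Φ x := (hΦapply x).symm

/-- **Schwartz envelope of a uniformly rapidly decreasing family.**  If `|G t x| (1 + ‖x‖)^N ≤ C_N` for all `t ∈ S`
and all `x`, with `C_N` independent of `t`, there is ONE non-negative Schwartz function `Φ` with `|G t x| ≤ Φ x` for all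
`t ∈ S` and all `x` (apply `exists_schwartz_ge_of_rapid_decay` to the pointwise supremum over `t ∈ S`).
[cite: HormanderALPDO1, Chap. VII §7.1 Def. 7.1.2] [cite: Rudin1991, §7.3] [cite: Weil1965, Chap. V n° 50] -/
theorem exists_schwartz_forall_ge_of_uniform_rapid_decay {T : Type*} {S : Set T} {G : T → V → ℝ}
    (hG : ∀ N : ℕ, ∃ C : ℝ, ∀ t ∈ S, ∀ x, |G t x| * (1 + ‖x‖) ^ N ≤ C) :
    ∃ Φ : SchwartzMap V ℝ, (∀ x, 0 ≤ Φ x) ∧ ∀ t ∈ S, ∀ x, |G t x| ≤ Φ x := by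
  -- the pointwise supremum over `t ∈ S` (bounded by the `N = 0` constant)
  choose C hC using hG
  let g : V → ℝ := fun x => sSup ((fun t => |G t x|) '' S)
  have hbdd : ∀ x, BddAbove ((fun t => |G t x|) '' S) := by
    intro x
    refine ⟨C 0, ?_⟩
    rintro _ ⟨t, ht, rfl⟩
    simpa using hC 0 t ht x
  have hg_ge : ∀ t ∈ S, ∀ x, |G t x| ≤ g x := fun t ht x => le_csSup (hbdd x) ⟨t, ht, rfl⟩
  have hg0 : ∀ x, 0 ≤ g x := by
    intro x
    by_cases hS : S.Nonempty
    · obtain ⟨t, ht⟩ := hS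
      exact (abs_nonneg _).trans (hg_ge t ht x)
    · rw [Set.not_nonempty_iff_eq_empty] at hS
      simp [g, hS]
  have hg : ∀ N : ℕ, ∃ C' : ℝ, ∀ x, |g x| * (1 + ‖x‖) ^ N ≤ C' := by
    intro N
    refine ⟨max (C N) 0, fun x => ?_⟩
    rw [abs_of_nonneg (hg0 x)]
    by_cases hS : S.Nonempty
    · have hne : ((fun t => |G t x|) '' S).Nonempty := hS.image _
      have hpos : 0 < (1 + ‖x‖) ^ N := pow_pos (by positivity) N
      rw [← le_div_iff₀ hpos]
      refine csSup_le hne ?_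
      rintro _ ⟨t, ht, rfl⟩
      rw [le_div_iff₀ hpos]
      exact (hC N t ht x).trans (le_max_left _ _)
    · rw [Set.not_nonempty_iff_eq_empty] at hS
      simp [g, hS]
  obtain ⟨Φ, hΦ0, hΦ⟩ := exists_schwartz_ge_of_rapid_decay hg
  exact ⟨Φ, hΦ0, fun t ht x => (hg_ge t ht x).trans ((le_abs_self _).trans (hΦ x))⟩

/-- **Complex-valued Schwartz envelope** (the form consumed by the adelic Schwartz–Bruhat spaces, whose archimedean
factors are `ℂ`-valued Mathlib Schwartz maps): under uniform rapid decay of `(G t)_{t ∈ S}` there is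
`Φ ∈ 𝓢(V, ℂ)`, REAL and NON-NEGATIVE pointwise (`(Φ x).im = 0`, `0 ≤ (Φ x).re`), with `|G t x| ≤ (Φ x).re`.
[cite: HormanderALPDO1, Chap. VII §7.1 Def. 7.1.2] [cite: Rudin1991, §7.3] [cite: Weil1965, Chap. V n° 50] -/
theorem exists_schwartz_complex_forall_ge_of_uniform_rapid_decay {T : Type*} {S : Set T} {G : T → V → ℝ}
    (hG : ∀ N : ℕ, ∃ C : ℝ, ∀ t ∈ S, ∀ x, |G t x| * (1 + ‖x‖) ^ N ≤ C) :
    ∃ Φ : SchwartzMap V ℂ, (∀ x, (Φ x).im = 0 ∧ 0 ≤ (Φ x).re) ∧ ∀ t ∈ S, ∀ x, |G t x| ≤ (Φ x).re := by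
  obtain ⟨Φ, hΦ0, hΦ⟩ := exists_schwartz_forall_ge_of_uniform_rapid_decay hG
  refine ⟨SchwartzMap.postcompCLM (𝕜 := ℝ) Complex.ofRealCLM Φ, fun x => ?_, fun t ht x => ?_⟩
  · rw [SchwartzMap.postcompCLM_apply]
    exact ⟨Complex.ofReal_im _, by simpa using hΦ0 x⟩
  · rw [SchwartzMap.postcompCLM_apply]
    simpa using hΦ t ht x

/-- **Complex-valued Schwartz envelope of one rapidly decreasing function.**
[cite: HormanderALPDO1, Chap. VII §7.1 Def. 7.1.2] [cite: Rudin1991, §7.3] [cite: Weil1965, Chap. V n° 50] -/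
theorem exists_schwartz_complex_ge_of_rapid_decay {G : V → ℝ}
    (hG : ∀ N : ℕ, ∃ C : ℝ, ∀ x, |G x| * (1 + ‖x‖) ^ N ≤ C) :
    ∃ Φ : SchwartzMap V ℂ, (∀ x, (Φ x).im = 0 ∧ 0 ≤ (Φ x).re) ∧ ∀ x, |G x| ≤ (Φ x).re := by
  obtain ⟨Φ, hΦ0, hΦ⟩ := exists_schwartz_complex_forall_ge_of_uniform_rapid_decay (S := (Set.univ : Set Unit))
    (G := fun _ => G) (fun N => (hG N).imp fun C hC _ _ x => hC x)
  exact ⟨Φ, hΦ0, fun x => hΦ () (Set.mem_univ _) x⟩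

/-- **Norm form for a family of complex-valued functions**: if `‖F t x‖ (1 + ‖x‖)^N ≤ C_N` uniformly in `t ∈ S`, there
is a real non-negative `Φ ∈ 𝓢(V, ℂ)` with `‖F t x‖ ≤ (Φ x).re` for all `t ∈ S`, `x` (the shape in which a compact family of
Schwartz functions, or of their dilates and Fourier transforms, is DOMINATED by one Schwartz function).
[cite: HormanderALPDO1, Chap. VII §7.1 Def. 7.1.2] [cite: Rudin1991, §7.3] [cite: Weil1965, Chap. V n° 50] -/
theorem exists_schwartz_complex_forall_norm_le_of_uniform_rapid_decay {T : Type*} {S : Set T} {W : Type*}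
    [NormedAddCommGroup W] {F : T → V → W}
    (hF : ∀ N : ℕ, ∃ C : ℝ, ∀ t ∈ S, ∀ x, ‖F t x‖ * (1 + ‖x‖) ^ N ≤ C) :
    ∃ Φ : SchwartzMap V ℂ, (∀ x, (Φ x).im = 0 ∧ 0 ≤ (Φ x).re) ∧ ∀ t ∈ S, ∀ x, ‖F t x‖ ≤ (Φ x).re := by
  obtain ⟨Φ, hΦ0, hΦ⟩ := exists_schwartz_complex_forall_ge_of_uniform_rapid_decay (G := fun t x => ‖F t x‖)
    (fun N => (hF N).imp fun C hC t ht x => by simpa [abs_of_nonneg (norm_nonneg _)] using hC t ht x)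
  exact ⟨Φ, hΦ0, fun t ht x => by simpa [abs_of_nonneg (norm_nonneg _)] using hΦ t ht x⟩

end Envelope

end Literature.Analysis.Distribution
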